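import Literature.Probability.Percolation.BoxCrossingLowerBound
import Literature.Probability.Percolation.HalfSpaceBrickSeeds
import HarnessLib

/-!
# RSW circuits fail in `k` disjoint annuli with probability `≤ (1 - c)^k`: stub
`stub_kernel_circuitsFail_pow` (K7) of line `hitting-tournament` for crux `LagHandOff`
(stmt-CriticalPhenomena-10268)

The probabilistic half of seat c5's "contacts accumulate" lemma for critical bond percolation
on `ℤ²` near the wired arc: if the RSW circuit bound `c ≤ P_{1/2}(O(l))` holds at every scale
`l ≥ 1` (Grimmett's event `O(l)`: an open circuit of the square annulus
`A(l) = B(3l) ∖ B(l)` around the origin, `openCircuitAround`,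
`Literature/Probability/Percolation/AnnulusCircuits.lean`), then for every lattice point `v`,
every `l₀ ≥ 1` and every `k`, the probability that NONE of the `k` annuli `v + A(l₀ 4^j)`,
`j < k`, contains an open circuit around `v` (`openCircuitAroundAt`,
`Literature/Probability/Percolation/LatticeTraceGeometry.lean`) is at most `(1 - c)^k`.

Proof (Grimmett, *Percolation* (1999), §11.7 with §2.2).

1. *Locality.* `openCircuitAroundAt v l` — hence its complement — is determined by the
   lattice pairs `{x, y}` with `x - v, y - v ∈ A(l)` (a witnessing cycle has its support in
   `v + A(l)`, so all its edges are such pairs): `determinedBy_openCircuitAroundAt`.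
2. *Disjointness.* For `j < j'` we have `3 · l₀ 4^j < l₀ 4^{j+1} ≤ l₀ 4^{j'}`, so
   `B(3 l₀ 4^j) ⊆ B(l₀ 4^{j'})` and the annuli `A(l₀ 4^j)`, `A(l₀ 4^{j'})` are disjoint; hence
   so are the two sets of pairs (`pairwiseDisjoint_annulusPairsAt`).
3. *Independence.* Events determined by pairwise disjoint edge sets are jointly independent
   under the product measure (`bondPercolation_real_biInter_eq_prod`,
   `Literature/Probability/Percolation/HalfSpaceBrickSeeds.lean`), so the probability of the
   intersection is the product of the `k` probabilities
   `1 - P(openCircuitAroundAt v (l₀ 4^j)) = 1 - P(O(l₀ 4^j)) ≤ 1 - c` (translation invariance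
   `bondPercolation_real_openCircuitAroundAt`, and the hypothesis at `l = l₀ 4^j ≥ 1`).

Helpers live in the sub-namespace `KernelCircuitsFail`.
-/

noncomputable section

open Set Metric MeasureTheory
open Literature.Probability.Percolation Literature.Probability.LatticeModels
open Literature.Probability.RandomPlanarGeometry

namespace Summit.CriticalPhenomena.CardyFormulaZ2.Cruxes.LagHandOff.HittingTournament

namespace KernelCircuitsFail

/-! ### Locality of the translated circuit event -/

/-- **`O(l)` around `v` depends only on the pairs of sites of `v + A(l)`.** The event
`openCircuitAroundAt v l` is determined by the set of pairs `{x, y}` with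
`x - v, y - v ∈ A(l) = annulus 2 l (3l)`: every edge of a witnessing cycle joins two vertices of
its support, which lies in `v + A(l)`. (Grimmett 1999, §11.7 with §2.2.) -/
theorem determinedBy_openCircuitAroundAt (v : Site 2) (l : ℕ) :
    DeterminedBy (openCircuitAroundAt v l)
      {e : Sym2 (Site 2) | ∀ x ∈ e, x - v ∈ annulus 2 l (3 * l)} := by
  rw [determinedBy_iff]
  suffices h : ∀ ω ω' : Set (Sym2 (Site 2)),
      ω ∩ {e : Sym2 (Site 2) | ∀ x ∈ e, x - v ∈ annulus 2 l (3 * l)} =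
        ω' ∩ {e : Sym2 (Site 2) | ∀ x ∈ e, x - v ∈ annulus 2 l (3 * l)} →
      ω ∈ openCircuitAroundAt v l → ω' ∈ openCircuitAroundAt v l from
    fun ω ω' hF => ⟨h ω ω' hF, h ω' ω hF.symm⟩
  rintro ω ω' hF ⟨u, w, hc, hs, he, ho⟩
  refine ⟨u, w, hc, hs, fun e he' => ?_, ho⟩
  have heF : e ∈ {e : Sym2 (Site 2) | ∀ x ∈ e, x - v ∈ annulus 2 l (3 * l)} :=
    fun x hx => hs x (w.mem_support_of_mem_edges he' hx)
  have : e ∈ ω ∩ {e : Sym2 (Site 2) | ∀ x ∈ e, x - v ∈ annulus 2 l (3 * l)} := ⟨he e he', heF⟩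
  rw [hF] at this
  exact this.1

/-- … hence so is the complement "no open circuit of `v + A(l)` around `v`". -/
theorem determinedBy_compl_openCircuitAroundAt (v : Site 2) (l : ℕ) :
    DeterminedBy (openCircuitAroundAt v l)ᶜ
      {e : Sym2 (Site 2) | ∀ x ∈ e, x - v ∈ annulus 2 l (3 * l)} :=
  (determinedBy_openCircuitAroundAt v l).compl

/-! ### The annuli `v + A(l₀ 4^j)` have pairwise disjoint sets of pairs -/

/-- For `j < j'` the annuli `A(l₀ 4^j) ⊆ B(3 l₀ 4^j)` and `A(l₀ 4^{j'}) = B(3 l₀ 4^{j'}) ∖ B(l₀ 4^{j'})`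
are disjoint, because `3 l₀ 4^j ≤ l₀ 4^{j'}`. -/
theorem not_mem_annulus_of_lt {l₀ j j' : ℕ} (hlt : j < j') {x : Site 2}
    (hx : x ∈ annulus 2 (l₀ * 4 ^ j) (3 * (l₀ * 4 ^ j))) :
    x ∉ annulus 2 (l₀ * 4 ^ j') (3 * (l₀ * 4 ^ j')) := by
  rw [mem_annulus] at hx ⊢
  rintro ⟨-, hx'⟩
  refine hx' (box_mono 2 ?_ hx.1)
  calc 3 * (l₀ * 4 ^ j) ≤ 4 * (l₀ * 4 ^ j) := Nat.mul_le_mul_right _ (by norm_num)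
    _ = l₀ * 4 ^ (j + 1) := by ring
    _ ≤ l₀ * 4 ^ j' := Nat.mul_le_mul_left _ (Nat.pow_le_pow_right (by norm_num) hlt)

/-- **The sets of pairs of sites of the annuli `v + A(l₀ 4^j)`, `j ∈ ℕ`, are pairwise
disjoint** (a common pair would have an endpoint in two disjoint annuli). -/
theorem pairwiseDisjoint_annulusPairsAt (v : Site 2) (l₀ : ℕ) (s : Set ℕ) :
    s.PairwiseDisjoint fun j =>
      {e : Sym2 (Site 2) | ∀ x ∈ e, x - v ∈ annulus 2 (l₀ * 4 ^ j) (3 * (l₀ * 4 ^ j))} := by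
  intro j _ j' _ hjj'
  refine Set.disjoint_left.2 fun e hej hej' => ?_
  have hx := hej _ (Sym2.out_fst_mem e)
  have hx' := hej' _ (Sym2.out_fst_mem e)
  rcases lt_or_gt_of_ne hjj' with h | h
  · exact not_mem_annulus_of_lt h hx hx'
  · exact not_mem_annulus_of_lt h hx' hx

/-! ### One annulus: the circuit fails with probability `≤ 1 - c` -/

/-- **One scale.** Under the RSW circuit bound `c ≤ P_{1/2}(O(l))` (`l ≥ 1`), for `l₀ ≥ 1` the
annulus `v + A(l₀ 4^j)` contains no open circuit around `v` with probability `≤ 1 - c`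
(complement rule and translation invariance `P(O(l) around v) = P(O(l))`). -/
theorem real_compl_openCircuitAroundAt_le {c : ℝ}
    (hc : ∀ l : ℕ, 1 ≤ l → c ≤ (bondPercolation (zdGraph 2) half).real (openCircuitAround l))
    (v : Site 2) {l₀ : ℕ} (hl₀ : 1 ≤ l₀) (j : ℕ) :
    (bondPercolation (zdGraph 2) half).real (openCircuitAroundAt v (l₀ * 4 ^ j))ᶜ ≤ 1 - c := by
  rw [measureReal_compl (measurableSet_openCircuitAroundAt v _), probReal_univ,
    bondPercolation_real_openCircuitAroundAt]
  have hl : 1 ≤ l₀ * 4 ^ j := Nat.mul_pos hl₀ (Nat.pow_pos (by norm_num))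
  linarith [hc (l₀ * 4 ^ j) hl]

end KernelCircuitsFail

open KernelCircuitsFail in
/-- **K7 `stub_kernel_circuitsFail_pow`.** If `c ≤ P_{1/2}(O(l))` for every `l ≥ 1` (RSW circuit
bound for Grimmett's event `O(l)`: an open circuit of `A(l) = B(3l) ∖ B(l)` around the origin),
then for every lattice point `v`, every `l₀ ≥ 1` and every `k`, the probability that none of
the `k` annuli `v + A(l₀ 4^j)`, `j < k`, carries an open circuit around `v` is at most
`(1 - c)^k`: the `k` complementary events are determined by the pairwise disjoint sets of pairs
of sites of the annuli (`3 · 4^j < 4^{j+1}`), hence independent under the product measure, and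
each has probability `1 - P(O(l₀ 4^j)) ≤ 1 - c` by translation invariance.
(Grimmett 1999, §11.7 with §2.2.) -/
theorem stub_kernel_circuitsFail_pow :
    ∀ (c : ℝ), (∀ l : ℕ, 1 ≤ l → c ≤ (bondPercolation (zdGraph 2) half).real (openCircuitAround l)) →
      ∀ (v : Site 2) (l₀ k : ℕ), 1 ≤ l₀ →
        (bondPercolation (zdGraph 2) half).real
            (⋂ j ∈ Finset.range k, (openCircuitAroundAt v (l₀ * 4 ^ j))ᶜ) ≤ (1 - c) ^ k := by
  intro c hc v l₀ k hl₀
  rw [bondPercolation_real_biInter_eq_prod (zdGraph 2) half (Finset.range k)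
    (fun j => (openCircuitAroundAt v (l₀ * 4 ^ j))ᶜ)
    (fun j => {e : Sym2 (Site 2) | ∀ x ∈ e, x - v ∈ annulus 2 (l₀ * 4 ^ j) (3 * (l₀ * 4 ^ j))})
    (fun j _ => determinedBy_compl_openCircuitAroundAt v _)
    (fun j _ => (measurableSet_openCircuitAroundAt v _).compl)
    (pairwiseDisjoint_annulusPairsAt v l₀ _)]
  calc ∏ j ∈ Finset.range k,
        (bondPercolation (zdGraph 2) half).real (openCircuitAroundAt v (l₀ * 4 ^ j))ᶜ
      ≤ ∏ _j ∈ Finset.range k, (1 - c) :=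
        Finset.prod_le_prod (fun _ _ => measureReal_nonneg) fun j _ =>
          real_compl_openCircuitAroundAt_le hc v hl₀ j
    _ = (1 - c) ^ k := by rw [Finset.prod_const, Finset.card_range]

end Summit.CriticalPhenomena.CardyFormulaZ2.Cruxes.LagHandOff.HittingTournament

end
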